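import Literature.AlgebraicGeometry.Frobenioids.PerfectionCoAngularPreSteps
import Literature.AlgebraicGeometry.Frobenioids.PreFrobenioidDataToFunctor
import HarnessLib

/-!
# Frobenioids I, Proposition 3.2 (iii), "`C^pf` is a Frobenioid": Definition 1.3 (v)(b)(c) and (vii)(a)(b)
# for the perfection (PROOFS)

Mochizuki, *The geometry of Frobenioids I: the general theory*, Kyushu J. Math. **62** (2008)
293–400, Definition 1.3 (v), (vii) p. 25, Definition 3.1 (iii) p. 57, Proposition 3.2 (iii) p. 59
[cite: MochizukiFrdI2008, Prop. 3.2 (iii) p.59]: "`C^pf` … is a Frobenioid … of perfect and isotropic type".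
This file is the clause-group (v)(b), (v)(c), (vii)(a), (vii)(b) of Def. 1.3 for THE perfection `Perfection hF`
of a Frobenioid `C` of Frobenius-isotropic type (the standing hypothesis of §3), at the level of the operations
`Perfection.ops hF` (abc-iut cell, row `FrdI:Prop3.2(iii)-frobenioid`, carve-up v2; assembly of
`IsFrobenioid (Perfection.ops hF).toFunctor` in `PerfectionIsFrobenioid.lean`).

All four clauses are immediate in `C^pf`, because `C^pf` is of isotropic type (`isOfIsotropicType_perfection`,
seat abc-iut-L1-d9): an isometric pre-step of `C^pf` is an isomorphism, and every arrow of `C^pf` is co-angular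
(`isCoAngular_of_frobeniusIsotropic`, seat abc-iut-w5-d246).  Hence a pre-step `φ` factors as `φ ≫ 𝟙`
(co-angular pre-step, then isometric pre-step) and as `𝟙 ≫ φ`, uniquely up to the evident isomorphisms; the
identity of every object is an isotropic hull; and isotropy propagates along arrows trivially.
No new definitions; nothing here is specific to the abc programme.
-/

namespace Literature.AlgebraicGeometry.Frobenioids

namespace PreFrobenioid

namespace Perfection

open CategoryTheory Opposite

universe w v v' u u'

variable {D : Type u} [Category.{v} D] {Φ : Dᵒᵖ ⥤ CommMonCat.{w}}
  {C : Type u'} [Category.{v'} C] {F : C ⥤ ElemFrobenioid Φ} {hF : IsFrobenioid F}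

/-! ### Isometric pre-steps of `C^pf` are isomorphisms -/

/-- For `C` of Frobenius-isotropic type, an isometric pre-step of `C^pf` is an isomorphism (`C^pf` is of
isotropic type, Prop. 3.2 (iii)). [cite: MochizukiFrdI2008, Prop. 3.2 (iii) p.59] -/
theorem isIso_of_isIsometry_of_isPreStep (hiso : IsOfType (IsFrobeniusIsotropic F)) {X Y : Perfection hF}
    (α : X ⟶ Y) (h₁ : (ops hF).IsIsometry α) (h₂ : (ops hF).IsPreStep α) : IsIso α :=
  (isOfIsotropicType_perfection hF hiso).obj X α ⟨h₂, h₁⟩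

/-- The identity of an object of `C^pf` is an isometric pre-step. [cite: MochizukiFrdI2008, Def. 1.2 (iii) p.22] -/
theorem isIsometry_id_and_isPreStep_id (X : Perfection hF) :
    (ops hF).IsIsometry (𝟙 X) ∧ (ops hF).IsPreStep (𝟙 X) :=
  ⟨(ops hF).div_id X, isPreStep_of_isIso (𝟙 X)⟩

/-! ### Definition 1.3 (v)(b), (c) for `C^pf` -/

/-- **Def. 1.3 (v)(b), existence, for `C^pf`**: a pre-step `φ` factors as a co-angular pre-step followed by an
isometric pre-step — namely `φ ≫ 𝟙`. [cite: MochizukiFrdI2008, Prop. 3.2 (iii) p.59] -/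
theorem v_b_exists_perfection (hiso : IsOfType (IsFrobeniusIsotropic F)) ⦃X Y : Perfection hF⦄ (φ : X ⟶ Y)
    (hφ : (ops hF).IsPreStep φ) :
    ∃ (Z : Perfection hF) (β : X ⟶ Z) (α : Z ⟶ Y), β ≫ α = φ ∧ (ops hF).IsCoAngularPreStep β ∧
      ((ops hF).IsIsometry α ∧ (ops hF).IsPreStep α) :=
  ⟨Y, φ, 𝟙 Y, Category.comp_id φ, ⟨isCoAngular_of_frobeniusIsotropic hiso φ, hφ⟩,
    isIsometry_id_and_isPreStep_id Y⟩

/-- **Def. 1.3 (v)(b), uniqueness, for `C^pf`**: two such factorisations `β ≫ α = φ = β′ ≫ α′` are related by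
the isomorphism `γ = α ≫ α′⁻¹` (the isometric pre-steps `α`, `α′` are isomorphisms).
[cite: MochizukiFrdI2008, Prop. 3.2 (iii) p.59] -/
theorem v_b_unique_perfection (hiso : IsOfType (IsFrobeniusIsotropic F)) ⦃X Y Z Z' : Perfection hF⦄
    (φ : X ⟶ Y) (β : X ⟶ Z) (α : Z ⟶ Y) (β' : X ⟶ Z') (α' : Z' ⟶ Y)
    (h : β ≫ α = φ) (_ : (ops hF).IsCoAngularPreStep β) (hα : (ops hF).IsIsometry α ∧ (ops hF).IsPreStep α)
    (h' : β' ≫ α' = φ) (_ : (ops hF).IsCoAngularPreStep β')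
    (hα' : (ops hF).IsIsometry α' ∧ (ops hF).IsPreStep α') :
    ∃ γ : Z ≅ Z', β ≫ γ.hom = β' ∧ α = γ.hom ≫ α' := by
  haveI := isIso_of_isIsometry_of_isPreStep hiso α hα.1 hα.2
  haveI := isIso_of_isIsometry_of_isPreStep hiso α' hα'.1 hα'.2
  refine ⟨asIso α ≪≫ (asIso α').symm, ?_, ?_⟩
  · change β ≫ α ≫ inv α' = β'
    rw [← cancel_mono α', Category.assoc, Category.assoc, IsIso.inv_hom_id, Category.comp_id, h, h']
  · change α = (α ≫ inv α') ≫ α'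
    rw [Category.assoc, IsIso.inv_hom_id, Category.comp_id]

/-- **Def. 1.3 (v)(c), existence, for `C^pf`**: a pre-step `φ` factors as an isometric pre-step followed by a
co-angular pre-step — namely `𝟙 ≫ φ`. [cite: MochizukiFrdI2008, Prop. 3.2 (iii) p.59] -/
theorem v_c_exists_perfection (hiso : IsOfType (IsFrobeniusIsotropic F)) ⦃X Y : Perfection hF⦄ (φ : X ⟶ Y)
    (hφ : (ops hF).IsPreStep φ) :
    ∃ (Z : Perfection hF) (β' : X ⟶ Z) (α' : Z ⟶ Y), β' ≫ α' = φ ∧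
      ((ops hF).IsIsometry β' ∧ (ops hF).IsPreStep β') ∧ (ops hF).IsCoAngularPreStep α' :=
  ⟨X, 𝟙 X, φ, Category.id_comp φ, isIsometry_id_and_isPreStep_id X,
    ⟨isCoAngular_of_frobeniusIsotropic hiso φ, hφ⟩⟩

/-- **Def. 1.3 (v)(c), uniqueness, for `C^pf`**: two such factorisations `β ≫ α = φ = β′ ≫ α′` are related by
the isomorphism `γ′ = β⁻¹ ≫ β′` (the isometric pre-steps `β`, `β′` are isomorphisms).
[cite: MochizukiFrdI2008, Prop. 3.2 (iii) p.59] -/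
theorem v_c_unique_perfection (hiso : IsOfType (IsFrobeniusIsotropic F)) ⦃X Y Z Z' : Perfection hF⦄
    (φ : X ⟶ Y) (β : X ⟶ Z) (α : Z ⟶ Y) (β' : X ⟶ Z') (α' : Z' ⟶ Y)
    (h : β ≫ α = φ) (hβ : (ops hF).IsIsometry β ∧ (ops hF).IsPreStep β) (_ : (ops hF).IsCoAngularPreStep α)
    (h' : β' ≫ α' = φ) (hβ' : (ops hF).IsIsometry β' ∧ (ops hF).IsPreStep β')
    (_ : (ops hF).IsCoAngularPreStep α') :
    ∃ γ : Z ≅ Z', β ≫ γ.hom = β' ∧ α = γ.hom ≫ α' := by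
  haveI := isIso_of_isIsometry_of_isPreStep hiso β hβ.1 hβ.2
  haveI := isIso_of_isIsometry_of_isPreStep hiso β' hβ'.1 hβ'.2
  refine ⟨(asIso β).symm ≪≫ asIso β', ?_, ?_⟩
  · change β ≫ inv β ≫ β' = β'
    rw [IsIso.hom_inv_id_assoc]
  · change α = (inv β ≫ β') ≫ α'
    rw [← cancel_epi β, Category.assoc, IsIso.hom_inv_id_assoc, h, h']

/-! ### Definition 1.3 (vii)(a), (b) for `C^pf` -/

/-- **Def. 1.3 (vii)(b) for `C^pf`**: isotropy propagates along arrows (every object of `C^pf` is isotropic).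
[cite: MochizukiFrdI2008, Prop. 3.2 (iii) p.59] -/
theorem vii_b_perfection (hiso : IsOfType (IsFrobeniusIsotropic F)) ⦃X Y : Perfection hF⦄ (_ : X ⟶ Y)
    (_ : (ops hF).IsIsotropic X) : (ops hF).IsIsotropic Y :=
  (isOfIsotropicType_perfection hF hiso).obj Y

/-- Every object of `C^pf` is isotropic, for the structure functor `C^pf → F_{Φ^pf}` (functor-level form).
[cite: MochizukiFrdI2008, Prop. 3.2 (iii) p.59] -/
theorem isIsotropic_toFunctor (hiso : IsOfType (IsFrobeniusIsotropic F)) (X : Perfection hF) :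
    PreFrobenioid.IsIsotropic (ops hF).toFunctor X :=
  (PreFrobenioidData.ofFunctor_isIsotropic (ops hF).toFunctor X).mp ((isOfIsotropicType_perfection hF hiso).obj X)

/-- **Def. 1.3 (vii)(a) for `C^pf`** (functor-level, for the structure functor `C^pf → F_{Φ^pf}`): every object has
an isotropic hull — its identity (the object is isotropic, and every arrow to an isotropic object factors
uniquely through the identity). [cite: MochizukiFrdI2008, Prop. 3.2 (iii) p.59] -/
theorem vii_a_perfection (hiso : IsOfType (IsFrobeniusIsotropic F)) (X : Perfection hF) :
    ∃ (Y : Perfection hF) (φ : X ⟶ Y), PreFrobenioid.IsIsotropicHull (ops hF).toFunctor φ := by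
  refine ⟨X, 𝟙 X, ?_, ?_, isIsotropic_toFunctor hiso X, fun Z γ _ => ⟨γ, Category.id_comp γ, fun β hβ => ?_⟩⟩
  · exact (isIsometry_id_and_isPreStep_id X).1
  · exact (PreFrobenioidData.isPreStep_toFunctor_iff (ops hF) (𝟙 X)).mpr (isIsometry_id_and_isPreStep_id X).2
  · rw [← hβ, Category.id_comp]

end Perfection

end PreFrobenioid

end Literature.AlgebraicGeometry.Frobenioids
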